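import Mathlib
import Literature.Analysis.FluidPDE.NewtonKernel
import HarnessLib

/-!
# Crux `ContinuumLegGivenGap` (stmt-QuantumFields-15828), line `duality-selection-nlo-skewness`: radial Schwartz bumps

Helper toward the registered stub `stub_KLSep_of` (lead c15, reshape c15-1; blueprint
`Cruxes/ContinuumLegGivenGap/Lines/duality-selection-KL-blueprint.md`, item (A)): for every radius `r > 0` a real,
non-negative, RADIAL (isometry-invariant) Schwartz bump on `ℝᵈ` supported in `closedBall 0 r`, equal to `1` on
`closedBall 0 (r/2)`, bounded by `1`, of strictly positive mass; and its mass-one normalisation. Built from the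
tree's smooth radial cutoff `Literature.Analysis.FluidPDE.radialCutoff` (a smooth function of `‖x‖²`) via
`HasCompactSupport.toSchwartzMap`. Existence form (no new definitions).
-/

noncomputable section

namespace Summit.QuantumFields.YangMills.Cruxes.ContinuumLegGivenGap.DualitySelectionNloSkewness

open scoped SchwartzMap
open MeasureTheory Literature.Analysis.FluidPDE

variable (d : ℕ)

/-- The complexified radial cutoff `x ↦ θ_{r/2,r}(x)` as a function `ℝᵈ → ℂ`. [folklore] -/
private theorem radialCutoffC_props {r : ℝ} (hr : 0 < r) :
    ContDiff ℝ (⊤ : ℕ∞) (fun x : (EuclideanSpace ℝ (Fin d)) => ((radialCutoff (r / 2) r x : ℝ) : ℂ)) ∧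
      HasCompactSupport (fun x : (EuclideanSpace ℝ (Fin d)) => ((radialCutoff (r / 2) r x : ℝ) : ℂ)) := by
  have h0 : (0 : ℝ) ≤ r / 2 := by positivity
  have h1 : r / 2 < r := by linarith
  refine ⟨?_, ?_⟩
  · exact (Complex.ofRealCLM.contDiff.of_le le_top).comp (radialCutoff_contDiff (r / 2) r)
  · exact (hasCompactSupport_radialCutoff (E := (EuclideanSpace ℝ (Fin d))) h0 h1).comp_left Complex.ofReal_zero

/-- **Radial Schwartz bumps of every radius.** For `r > 0` there is `φ ∈ 𝓢(ℝᵈ, ℂ)`, real-valued with values in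
`[0, 1]`, invariant under every linear isometry, supported in `closedBall 0 r`, equal to `1` on `closedBall 0 (r/2)`,
with real strictly positive mass. [folklore] -/
theorem exists_radialBump {r : ℝ} (hr : 0 < r) :
    ∃ φ : 𝓢((EuclideanSpace ℝ (Fin d)), ℂ),
      (∀ x, (φ x).im = 0 ∧ 0 ≤ (φ x).re) ∧ (∀ x, (φ x).re ≤ 1) ∧
      (∀ (L : (EuclideanSpace ℝ (Fin d)) ≃ₗᵢ[ℝ] (EuclideanSpace ℝ (Fin d))) (x : (EuclideanSpace ℝ (Fin d))), φ (L x) = φ x) ∧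
      tsupport (φ : (EuclideanSpace ℝ (Fin d)) → ℂ) ⊆ Metric.closedBall 0 r ∧
      (∀ x : (EuclideanSpace ℝ (Fin d)), ‖x‖ ≤ r / 2 → φ x = 1) ∧
      (∫ x, φ x).im = 0 ∧ 0 < (∫ x, φ x).re := by
  have h0 : (0 : ℝ) ≤ r / 2 := by positivity
  have h1 : r / 2 < r := by linarith
  obtain ⟨hsmooth, hsupp⟩ := radialCutoffC_props d hr
  set φ : 𝓢((EuclideanSpace ℝ (Fin d)), ℂ) := hsupp.toSchwartzMap hsmooth with hφ
  have happ : ∀ x, φ x = ((radialCutoff (r / 2) r x : ℝ) : ℂ) := fun _ => rfl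
  have hcoe : (φ : (EuclideanSpace ℝ (Fin d)) → ℂ) = fun x => ((radialCutoff (r / 2) r x : ℝ) : ℂ) := rfl
  refine ⟨φ, ?_, ?_, ?_, ?_, ?_, ?_⟩
  · intro x
    rw [happ, Complex.ofReal_im, Complex.ofReal_re]
    exact ⟨rfl, radialCutoff_nonneg _ _ _⟩
  · intro x
    rw [happ, Complex.ofReal_re]
    exact radialCutoff_le_one _ _ _
  · intro L x
    rw [happ, happ, radialCutoff_radial (r / 2) r (L.norm_map x)]
  · intro x hx
    rw [hcoe] at hx
    have hx' : x ∈ tsupport (radialCutoff (r / 2) r : (EuclideanSpace ℝ (Fin d)) → ℝ) :=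
      tsupport_comp_subset (g := fun t : ℝ => (t : ℂ)) Complex.ofReal_zero _ hx
    exact tsupport_radialCutoff_subset h0 h1 hx'
  · intro x hx
    rw [happ, Complex.ofReal_eq_one]
    exact radialCutoff_eq_one h0 h1 hx
  · have hint : ∫ x : (EuclideanSpace ℝ (Fin d)), φ x = ((∫ x : (EuclideanSpace ℝ (Fin d)), radialCutoff (r / 2) r x : ℝ) : ℂ) := by
      simp only [happ]
      exact integral_complex_ofReal
    rw [hint, Complex.ofReal_im, Complex.ofReal_re]
    refine ⟨rfl, ?_⟩
    refine (radialCutoff_contDiff (r / 2) r (n := 0)).continuous.integral_pos_of_hasCompactSupport_nonneg_nonzero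
      (hasCompactSupport_radialCutoff h0 h1) (fun x => radialCutoff_nonneg _ _ x) (x := 0) ?_
    rw [radialCutoff_eq_one h0 h1 (by simp only [norm_zero]; positivity)]
    exact one_ne_zero

/-- **Mass-one radial Schwartz bumps of every radius**: as `exists_radialBump`, normalised to `∫ φ = 1` (still real,
non-negative, radial, supported in `closedBall 0 r`, and strictly positive at the origin). [folklore] -/
theorem exists_unitRadialBump {r : ℝ} (hr : 0 < r) :
    ∃ φ : 𝓢((EuclideanSpace ℝ (Fin d)), ℂ),
      (∀ x, (φ x).im = 0 ∧ 0 ≤ (φ x).re) ∧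
      (∀ (L : (EuclideanSpace ℝ (Fin d)) ≃ₗᵢ[ℝ] (EuclideanSpace ℝ (Fin d))) (x : (EuclideanSpace ℝ (Fin d))), φ (L x) = φ x) ∧
      tsupport (φ : (EuclideanSpace ℝ (Fin d)) → ℂ) ⊆ Metric.closedBall 0 r ∧
      (∫ x, φ x) = 1 ∧ 0 < (φ 0).re := by
  obtain ⟨φ, hre, -, hrad, hsupp, hone, him, hpos⟩ := exists_radialBump d hr
  set m : ℝ := (∫ x, φ x).re with hm
  have hmC : (∫ x, φ x) = (m : ℂ) := Complex.ext (by simp [hm]) (by simp [him])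
  refine ⟨((m⁻¹ : ℝ) : ℂ) • φ, ?_, ?_, ?_, ?_, ?_⟩
  · intro x
    simp only [smul_apply, smul_eq_mul, Complex.mul_im, Complex.ofReal_re, Complex.ofReal_im,
      zero_mul, add_zero, Complex.mul_re, sub_zero]
    refine ⟨by rw [(hre x).1, mul_zero], mul_nonneg (inv_nonneg.2 hpos.le) (hre x).2⟩
  · intro L x
    simp only [smul_apply, hrad L x]
  · refine (tsupport_smul_subset_right (fun _ : (EuclideanSpace ℝ (Fin d)) => ((m⁻¹ : ℝ) : ℂ)) (φ : (EuclideanSpace ℝ (Fin d)) → ℂ)).trans hsupp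
  · have h1 : (fun x : (EuclideanSpace ℝ (Fin d)) => (((m⁻¹ : ℝ) : ℂ) • φ) x) = fun x => ((m⁻¹ : ℝ) : ℂ) • φ x := by
      funext x; exact smul_apply _ _ _
    rw [h1, integral_smul, hmC, smul_eq_mul, ← Complex.ofReal_mul, inv_mul_cancel₀ hpos.ne', Complex.ofReal_one]
  · simp only [smul_apply, smul_eq_mul, Complex.mul_re, Complex.ofReal_re, Complex.ofReal_im,
      zero_mul, sub_zero]
    rw [hone 0 (by simp only [norm_zero]; positivity)]
    simp only [Complex.one_re, mul_one, inv_pos]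
    exact hpos

end Summit.QuantumFields.YangMills.Cruxes.ContinuumLegGivenGap.DualitySelectionNloSkewness

end
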